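import Literature.NumberTheory.Transcendental.AntiEFunction
import HarnessLib

/-!
# Borel–Laplace sums of Э-series are linear (same ray, same point)

`Literature/NumberTheory/Transcendental/BorelLaplaceSumLinear.lean` — small PROVED API for
`Literature/NumberTheory/Transcendental/AntiEFunction.lean`: analytic continuations of
`G`-series along a ray (`IsBorelRayContinuation`) and Borel–Laplace sums (`IsBorelLaplaceSum`)
are stable under differences and constant multiples, and the constant Э-function `β` sums to `β`
at `z = 1` in every direction `|d| < π/2`. This is the (trivial) linearity underlying "`𝐃` … [is
a] sub-ring of `ℂ`" [FischlerRivoal2018, §4.3] in the regular case, and it is what is needed to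
form the Э-function `β − 𝔣` with vanishing `1`-sum in the proof of
[FischlerRivoal2024, Proposition 4 / Corollary 1]
(`Literature/NumberTheory/Transcendental/FischlerRivoalCorollary1Reduction.lean`).

## References

* [FischlerRivoal2018] S. Fischler, T. Rivoal, Amer. J. Math. 140 (2018), §4.3.
-/

noncomputable section

open Complex MeasureTheory Set Filter Real Finset
open scoped Nat Topology

namespace Literature.NumberTheory.Transcendental

open Literature.Barriers.Schanuel

/-! ### 1. Linearity of Borel–Laplace sums -/

/-- Continuations subtract. [folklore] -/
theorem IsBorelRayContinuation.sub {a b : ℕ → ℂ} {d : ℝ} {G H : ℂ → ℂ}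
    (hG : IsBorelRayContinuation a d G) (hH : IsBorelRayContinuation b d H) :
    IsBorelRayContinuation (fun n => a n - b n) d (fun ξ => G ξ - H ξ) := by
  obtain ⟨U, hU, hRU, hGU⟩ := hG.exists_isOpen
  obtain ⟨V, hV, hRV, hHV⟩ := hH.exists_isOpen
  refine ⟨⟨U ∩ V, hU.inter hV, subset_inter hRU hRV,
    (hGU.mono inter_subset_left).sub (hHV.mono inter_subset_right)⟩, ?_⟩
  filter_upwards [hG.hasSum_nhds_zero, hH.hasSum_nhds_zero] with ξ h₁ h₂
  simpa [sub_mul] using h₁.sub h₂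

/-- Continuations scale. [folklore] -/
theorem IsBorelRayContinuation.const_mul {a : ℕ → ℂ} {d : ℝ} {G : ℂ → ℂ} (β : ℂ)
    (hG : IsBorelRayContinuation a d G) :
    IsBorelRayContinuation (fun n => β * a n) d (fun ξ => β * G ξ) := by
  obtain ⟨U, hU, hRU, hGU⟩ := hG.exists_isOpen
  refine ⟨⟨U, hU, hRU, hGU.const_mul β⟩, ?_⟩
  filter_upwards [hG.hasSum_nhds_zero] with ξ h
  simpa [mul_assoc] using h.mul_left β

/-- **Borel–Laplace sums subtract** (same ray, same point). PROVED. [folklore] -/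
theorem IsBorelLaplaceSum.sub {a b : ℕ → ℂ} {d : ℝ} {z w₁ w₂ : ℂ}
    (h₁ : IsBorelLaplaceSum a d z w₁) (h₂ : IsBorelLaplaceSum b d z w₂) :
    IsBorelLaplaceSum (fun n => a n - b n) d z (w₁ - w₂) := by
  obtain ⟨G, hG, hGi, rfl⟩ := h₁
  obtain ⟨H, hH, hHi, rfl⟩ := h₂
  have hint_eq : antiELaplaceIntegrand (fun ξ => G ξ - H ξ) d z =
      fun r => antiELaplaceIntegrand G d z r - antiELaplaceIntegrand H d z r := by
    funext r
    simp only [antiELaplaceIntegrand]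
    ring
  refine ⟨fun ξ => G ξ - H ξ, hG.sub hH, ?_, ?_⟩
  · rw [hint_eq]
    exact hGi.sub hHi
  · rw [antiELaplace, antiELaplace, antiELaplace, hint_eq, integral_sub hGi hHi]
    ring

/-- **Borel–Laplace sums scale** by constants. PROVED. [folklore] -/
theorem IsBorelLaplaceSum.const_mul {a : ℕ → ℂ} {d : ℝ} {z w : ℂ} (β : ℂ)
    (h : IsBorelLaplaceSum a d z w) :
    IsBorelLaplaceSum (fun n => β * a n) d z (β * w) := by
  obtain ⟨G, hG, hGi, rfl⟩ := h
  have hint_eq : antiELaplaceIntegrand (fun ξ => β * G ξ) d z =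
      fun r => β * antiELaplaceIntegrand G d z r := by
    funext r
    simp only [antiELaplaceIntegrand]
    ring
  refine ⟨fun ξ => β * G ξ, hG.const_mul β, ?_, ?_⟩
  · rw [hint_eq]
    exact hGi.const_mul β
  · rw [antiELaplace, antiELaplace, hint_eq, integral_const_mul]
    ring

/-- The constant Э-function `β` (`= 𝔣_a`, `a = β·(1,0,0,…)`) has `1`-sum `β` at `z = 1` along every
ray of direction `|d| < π/2`. PROVED. [folklore] -/
theorem isBorelLaplaceSum_const_mul_deltaZero_one (β : ℂ) {d : ℝ}
    (hd : d ∈ Ioo (-(Real.pi / 2)) (Real.pi / 2)) :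
    IsBorelLaplaceSum (fun n => β * deltaZero n) d 1 β := by
  simpa using (isBorelLaplaceSum_deltaZero_one hd).const_mul β

end Literature.NumberTheory.Transcendental

end
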